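import Mathlib
import HarnessLib
import Summits.HubbardSuperconductivity.HubbardSuperconductivity.Theorems.KLProgrammeKLRegimeEngineLadderIncrement
import Summits.HubbardSuperconductivity.HubbardSuperconductivity.Theorems.KLProgrammeKLRegimeTwoPointLimitCooperResummationComplexMass

/-!
# Route `KLProgramme` — crux K3, ENGINE child gen 4 (stmt-HubbardSuperconductivity-19855), clause (E2-v8) at `1 ≤ n`:
# the remainder PROPAGATED to the irreducible increment — `|𝒞′_n − T_K| ≤ 36·sup|δI_n|` and the assembled constructor
# `pairLadderStepAtV8_of_irreducibleIncrement`

Cell gate-hubbard-kl, seat hubbard-kl-k3c1-p1 (g4), technique «composed-map remainder propagation».  Assembles `…EngineLadderIncrement`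
(p479984: one-slice Bethe–Salpeter form `pairLadderStepAtV8_of_sliceBS`, composition / increment identities) with `…CooperResummationComplexMass`
(p480970: Sherman–Morrison structure and the mass-uniform Lipschitz constant `36` for COMPLEX rungs under the signed-mass allowance
`u·(Σ‖z‖ − Re Σz) ≤ 1/4`).  Writing `F_z(X) := (1 + X·diag z)⁻¹·X`, `J = u·𝟙𝟙ᵀ`:

* `klcrc_increment_le` (generic finite carrier): for old / new irreducible kernels `u·J + 𝒟`, `u·J + 𝒟′` (`|𝒟|, |𝒟′| ≤ δ`, `|𝒟′ − 𝒟| ≤ η₁`),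
  cumulative rungs `B` and increment `w` (both with `Z·δ ≤ 1/3`, `u·𝔑 ≤ 1/4` at `B` and at `B + w`):
  `|F_{B+w}(u·J + 𝒟′) − F_w(F_B(u·J + 𝒟))| ≤ 36·η₁` entrywise — the per-scale (E2) remainder is the irreducible increment, with NO
  amplification by the accumulated mass (`klcrf_compose` + `klcrc_lipschitz`).
* `pairLadderStepAtV8_of_irreducibleIncrement` (model, BY NAME on BundleV12): per pair class the engine supplies the running value `u ≥ 0`, the
  old / new irreducible deviations `𝒟, 𝒟′` on `TorusSite 2 L × F` with `sup|𝒟′ − 𝒟| ≤ η₁`, the cumulative rungs `B` (masses at `B`), the FULL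
  step rungs `z′` ((m)/(neg)/(real) as in the text; `(4u/3 + 9δ)·Σ‖z′‖ ≤ 1/3`), a right inverse `N` of `1 + diag z′·J′` for the one-slice kernel
  `J′ := F_B(u·J + 𝒟′)` with the Bethe–Salpeter identity `𝒞_n(Qm;k,k′) = (J′·N)((k,a₀),(k′,a₀))`, the localisation `‖K(a,b) − 𝒞̂_{n−1}(Qm;a.1,b.1)‖
  ≤ ε` of the old array `K := F_B(u·J + 𝒟)` on relevant-or-external pairs, and the budget line `81·η₁ + (9/4)·ε ≤ drivePBar + eremBar +
  thermalBar + legDressBarQ·countT` ⇒ `PairLadderStepAtV8 … n`.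
Linear algebra + bookkeeping only; nothing about the model is asserted.  0 kit.
-/

noncomputable section

namespace Summit.HubbardSuperconductivity.HubbardSuperconductivity.Theorems.KLRegimeSplit

set_option linter.dupNamespace false -- summit = problem name (single-conjunct summit), D-0017

open Finset Matrix Literature.MathematicalPhysics.QuantumLattice Literature.Probability.LatticeModels
open Summit.HubbardSuperconductivity.HubbardSuperconductivity.Theorems.KLProgrammeCooperResummation
open Summit.HubbardSuperconductivity.HubbardSuperconductivity.Theorems.KLProgrammeLegKernels

/-! ## §1 The propagated remainder: `|F_{B+w}(uJ + 𝒟′) − F_w(F_B(uJ + 𝒟))| ≤ 36·sup|𝒟′ − 𝒟|` -/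

section Generic

variable {ι : Type*} [Fintype ι] [DecidableEq ι] [Nonempty ι]

/-- **Remainder propagation through the cumulative rungs (complex weights, mass-uniform).**  With `X = u·J + 𝒟`, `X′ = u·J + 𝒟′`
(`|𝒟|, |𝒟′| ≤ δ`, `|𝒟′ − 𝒟| ≤ η₁`), cumulative rungs `B` and increment `w` such that `Z·δ ≤ 1/3` and `u·(Z − Re Σ) ≤ 1/4` hold at `B` and at
`B + w`, and `K := F_B(X)` the old resummed array: every entry of `F_{B+w}(X′) − F_w(K)` is `≤ 36·η₁`.  (`F_w(K) = F_{B+w}(X)` by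
`klcrf_compose`, then `klcrc_lipschitz` at the rungs `B + w`.) -/
theorem klcrc_increment_le (B w : ι → ℂ) {u δ η₁ : ℝ} (hu : 0 ≤ u) (hδ : 0 ≤ δ) (hη₁ : 0 ≤ η₁)
    (𝒟 𝒟' : Matrix ι ι ℂ) (h𝒟 : ∀ s t, ‖𝒟 s t‖ ≤ δ) (h𝒟' : ∀ s t, ‖𝒟' s t‖ ≤ δ) (hE : ∀ s t, ‖(𝒟' - 𝒟) s t‖ ≤ η₁)
    (hθB : (∑ s, ‖B s‖) * δ ≤ 1 / 3) (h𝔑B : u * ((∑ s, ‖B s‖) - (∑ s, B s).re) ≤ 1 / 4)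
    (hθ' : (∑ s, ‖(B + w) s‖) * δ ≤ 1 / 3) (h𝔑' : u * ((∑ s, ‖(B + w) s‖) - (∑ s, (B + w) s).re) ≤ 1 / 4) (x y : ι) :
    ‖((1 + (Matrix.of (fun _ _ : ι => (u : ℂ)) + 𝒟') * Matrix.diagonal (B + w))⁻¹ * (Matrix.of (fun _ _ : ι => (u : ℂ)) + 𝒟') -
        (1 + ((1 + (Matrix.of (fun _ _ : ι => (u : ℂ)) + 𝒟) * Matrix.diagonal B)⁻¹ * (Matrix.of (fun _ _ : ι => (u : ℂ)) + 𝒟)) *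
              Matrix.diagonal w)⁻¹ *
          ((1 + (Matrix.of (fun _ _ : ι => (u : ℂ)) + 𝒟) * Matrix.diagonal B)⁻¹ * (Matrix.of (fun _ _ : ι => (u : ℂ)) + 𝒟))) x y‖ ≤
      36 * η₁ := by
  set X : Matrix ι ι ℂ := Matrix.of (fun _ _ : ι => (u : ℂ)) + 𝒟 with hX_def
  obtain ⟨hUB, -, -⟩ := klcrc_structure B hu hδ 𝒟 h𝒟 hθB h𝔑B
  obtain ⟨hU', -, -⟩ := klcrc_structure (B + w) hu hδ 𝒟 h𝒟 hθ' h𝔑'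
  have hdiag : Matrix.diagonal (B + w) = Matrix.diagonal B + Matrix.diagonal w := (Matrix.diagonal_add B w).symm
  have hU12 : IsUnit (1 + X * (Matrix.diagonal B + Matrix.diagonal w)) := by rw [← hdiag]; exact hU'
  have hcomp := klcrf_compose X (Matrix.diagonal B) (Matrix.diagonal w) hUB hU12
  rw [hcomp, ← hdiag]
  exact klcrc_lipschitz (B + w) hu hδ hη₁ 𝒟' 𝒟 h𝒟' h𝒟 hE hθ' h𝔑' x y

end Generic

/-! ## §2 (E2-v8) at `1 ≤ n` from the irreducible increment -/

section Model

variable (L M : ℕ) [NeZero L] [NeZero M]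
variable {F : Type*} [Fintype F] [DecidableEq F] [Nonempty F]

set_option maxHeartbeats 400000 in
/-- **(E2-v8) at `1 ≤ n` from the IRREDUCIBLE INCREMENT.**  Fix `F`, `a₀ : F`; write `ι = TorusSite 2 L × F`, `J = u·𝟙𝟙ᵀ`,
`F_z(X) = (1 + X·diag z)⁻¹·X`.  Per pair class `Qm` the engine supplies: the running value `u ≥ 0`; the old / new irreducible deviations
`𝒟, 𝒟′` (`|𝒟|, |𝒟′| ≤ δ`, `|𝒟′ − 𝒟| ≤ η₁` entrywise — `𝒟′ − 𝒟 = δI_n`, the pair-irreducible blocks with a slice-`n` line); the cumulative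
rungs `B` of the steps `< n` (`(Σ‖B‖)·δ ≤ 1/3`, `u·(Σ‖B‖ − Re ΣB) ≤ 1/4`); the FULL step-`n` rungs `z′` (`(4u/3 + 9δ)·Σ‖z′‖ ≤ 1/3`,
`Σ‖z′‖ ≤ G.bhi`, (neg), (real)); a right inverse `N` of `1 + diag z′·J′` for the one-slice kernel `J′ := F_B(u·J + 𝒟′)` together with the
BETHE–SALPETER identity `𝒞_n(Qm;k,k′) = (J′·N)((k,a₀),(k′,a₀))` on the ball; the localisation `‖K(a,b) − 𝒞̂_{n−1}(Qm;a.1,b.1)‖ ≤ ε` of the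
old array `K := F_B(u·J + 𝒟)` on relevant-or-external pairs; and the budget line `81·η₁ + (9/4)·ε ≤ drivePBar + eremBar + thermalBar +
legDressBarQ·countT` at every external pair.  Then `PairLadderStepAtV8 … n`.  (Proof: `|J′| ≤ 4u/3 + 9δ` by `klcrc_entry_le`; `|J′ − K| ≤
36η₁` by `klcrc_lipschitz` at the rungs `B`; hence the sup bound of `pairLadderStepAtV8_of_sliceBS` holds with `η = 36η₁ + ε`.) -/
theorem pairLadderStepAtV8_of_irreducibleIncrement {G : GeoConsts} {P : SplitConsts} {Q : EngConsts} {β U μ : ℝ} {K₀ : TrigPolyC4v}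
    {n : ℕ} (a₀ : F) (hn : 1 ≤ n)
    (hsplit : PairArrayAtV2 L M P Q β U μ K₀ (n - 1)) (hD : 0 ≤ P.C_W + klLegKappa * Q.CR * P.Klam ^ 3)
    (hsmall : G.bhi * (2 * |U| + (P.C_W + klLegKappa * Q.CR * P.Klam ^ 3) * U ^ 2) ≤ 1 / 3)
    (hinc : ∀ Qm : TorusSite 2 L, IsPairClassAt L Qm n →
      ∃ (u δ ε η₁ : ℝ) (𝒟 𝒟' : Matrix (TorusSite 2 L × F) (TorusSite 2 L × F) ℂ) (B z' : TorusSite 2 L × F → ℂ)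
        (N : Matrix (TorusSite 2 L × F) (TorusSite 2 L × F) ℂ),
        0 ≤ u ∧ 0 ≤ δ ∧ (∀ a b, ‖𝒟 a b‖ ≤ δ) ∧ (∀ a b, ‖𝒟' a b‖ ≤ δ) ∧ 0 ≤ η₁ ∧ (∀ a b, ‖(𝒟' - 𝒟) a b‖ ≤ η₁) ∧
        (∑ a, ‖B a‖) * δ ≤ 1 / 3 ∧ u * ((∑ a, ‖B a‖) - (∑ a, B a).re) ≤ 1 / 4 ∧
        (4 / 3 * u + 9 * δ) * ∑ x, ‖z' x‖ ≤ 1 / 3 ∧ ∑ x, ‖z' x‖ ≤ G.bhi ∧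
        (∑ p, ‖∑ b, z' (p, b)‖) - (∑ p, ∑ b, z' (p, b)).re ≤ 2 * klEdge G n (klTorusNorm L Qm) ∧ (∀ p, (∑ b, z' (p, b)).im = 0) ∧
        (1 + Matrix.diagonal z' *
              ((1 + (Matrix.of (fun _ _ : TorusSite 2 L × F => (u : ℂ)) + 𝒟') * Matrix.diagonal B)⁻¹ * (Matrix.of (fun _ _ : TorusSite 2 L × F => (u : ℂ)) + 𝒟'))) * N = 1 ∧
        (∀ k ∈ klBall L μ K₀, ∀ k' ∈ klBall L μ K₀,
          klPairAmplitude L M β U μ K₀ n Qm k k' =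
            (((1 + (Matrix.of (fun _ _ : TorusSite 2 L × F => (u : ℂ)) + 𝒟') * Matrix.diagonal B)⁻¹ * (Matrix.of (fun _ _ : TorusSite 2 L × F => (u : ℂ)) + 𝒟')) * N)
              (k, a₀) (k', a₀)) ∧
        0 ≤ ε ∧
        (∀ a b : TorusSite 2 L × F, (z' a ≠ 0 ∨ (a.1 ∈ klBall L μ K₀ ∧ a.2 = a₀)) → (z' b ≠ 0 ∨ (b.1 ∈ klBall L μ K₀ ∧ b.2 = a₀)) →
          ‖((1 + (Matrix.of (fun _ _ : TorusSite 2 L × F => (u : ℂ)) + 𝒟) * Matrix.diagonal B)⁻¹ * (Matrix.of (fun _ _ : TorusSite 2 L × F => (u : ℂ)) + 𝒟)) a b -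
              klPairArray L M β U μ K₀ (n - 1) Qm a.1 b.1‖ ≤ ε) ∧
        ∀ k ∈ klBall L μ K₀, ∀ k' ∈ klBall L μ K₀,
          81 * η₁ + 9 / 4 * ε ≤ drivePBar G P U (n - 1) + eremBar G P Q U β L (n - 1) + thermalBar G P U β n +
            legDressBarQ G P Q U n (legSliceCountT L β μ K₀ n ![k', Qm - k', Qm - k, k])) :
    PairLadderStepAtV8 L M G P Q β U μ K₀ n := by
  refine pairLadderStepAtV8_of_sliceBS L M a₀ hn hsplit hD hsmall fun Qm hQm => ?_
  obtain ⟨u, δ, ε, η₁, 𝒟, 𝒟', B, z', N, hu, hδ, h𝒟, h𝒟', hη₁, hE, hθB, h𝔑B, hzJ, hzsum, hmass, hreal, hN, hbs, hε, hloc, hbud⟩ :=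
    hinc Qm hQm
  set J' : Matrix (TorusSite 2 L × F) (TorusSite 2 L × F) ℂ :=
    ((1 + (Matrix.of (fun _ _ : TorusSite 2 L × F => (u : ℂ)) + 𝒟') * Matrix.diagonal B)⁻¹ * (Matrix.of (fun _ _ : TorusSite 2 L × F => (u : ℂ)) + 𝒟')) with hJ'_def
  set K : Matrix (TorusSite 2 L × F) (TorusSite 2 L × F) ℂ :=
    ((1 + (Matrix.of (fun _ _ : TorusSite 2 L × F => (u : ℂ)) + 𝒟) * Matrix.diagonal B)⁻¹ * (Matrix.of (fun _ _ : TorusSite 2 L × F => (u : ℂ)) + 𝒟)) with hK_def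
  -- entries of the one-slice kernel and its distance to the old array
  have hJ'le : ∀ x y, ‖J' x y‖ ≤ 4 / 3 * u + 9 * δ := fun x y => klcrc_entry_le B hu hδ 𝒟' h𝒟' hθB h𝔑B x y
  have hJ'K : ∀ x y, ‖J' x y - K x y‖ ≤ 36 * η₁ := by
    intro x y
    have h := klcrc_lipschitz B hu hδ hη₁ 𝒟' 𝒟 h𝒟' h𝒟 hE hθB h𝔑B x y
    rw [Matrix.sub_apply] at h
    exact h
  have hm' : 0 ≤ 4 / 3 * u + 9 * δ := by positivity
  refine ⟨J', z', N, 4 / 3 * u + 9 * δ, 36 * η₁ + ε, hm', hJ'le, hzJ, hzsum, hmass, hreal, hN, hbs, by positivity, ?_, ?_⟩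
  · intro a b ha hb
    calc ‖J' a b - klPairArray L M β U μ K₀ (n - 1) Qm a.1 b.1‖
        = ‖(J' a b - K a b) + (K a b - klPairArray L M β U μ K₀ (n - 1) Qm a.1 b.1)‖ := by rw [sub_add_sub_cancel]
      _ ≤ ‖J' a b - K a b‖ + ‖K a b - klPairArray L M β U μ K₀ (n - 1) Qm a.1 b.1‖ := norm_add_le _ _
      _ ≤ 36 * η₁ + ε := add_le_add (hJ'K a b) (hloc a b ha hb)
  · intro k hk k' hk'
    have h := hbud k hk k' hk'
    have : 9 / 4 * (36 * η₁ + ε) = 81 * η₁ + 9 / 4 * ε := by ring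
    rw [this]
    exact h

end Model

end Summit.HubbardSuperconductivity.HubbardSuperconductivity.Theorems.KLRegimeSplit

end
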